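import Summits.BirchSwinnertonDyer.Rank1Residual.X5.TwoAdicInstancesMultAnchorsS
import Summits.BirchSwinnertonDyer.Rank1Residual.X5.TwoAdicInstances144027d
import Summits.BirchSwinnertonDyer.Rank1Residual.X5.TwoAdicInstancesToolkitC
import Summits.BirchSwinnertonDyer.Rank1Residual.X5.TwoAdicInstancesToolkitD
import Summits.BirchSwinnertonDyer.BirchSwinnertonDyer.Theorems.Rank2ObservatoryRootNumberCert3
import HarnessLib

/-!
# X5 at `p = 2` (cell `bsd-2adic`, seat `bsd-2adic-t42`, GEN 7): SPLIT ANCHORS `1170i2`, `1246h1` for DOOR (34-GV-mult) — curve data only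

HONEST FRAMING (cell `bsd-2adic`, run/shared/lean/pub/bsd-2adic/, HUMAN RULINGS D-0036 / D-0054): research route; NO door theorem,
nothing displayed, nothing booked; BSD is not proved by any of this. PARTITION: X5@2 multiplicative (K4ᵐ, RESIDUAL-MAP B1·O1;
tranche 1 of the GV-mult habitat) × p = 2 — types-the-object-of (anchor curves for the congruence transport; closes none).
WHAT: the split multiplicative ANCHORS (`2 ∥ N`, `r = 1` (RANK-AWARE: `λ(X_A) = m` is pinned in the class files by K11 + Greenberg Thm. 1.9 from a displayed `hrankA`), exactly one rational `2`-torsion point, of Greenberg type A or B) that the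
tranche-1 classes of HOME/t42/DESIGN-T42-ADDENDUM-8.md need and that are NOT in the mult lane's anchors files
`X5/TwoAdicInstancesMultAnchors{A,B,C,S}.lean` (one writer per object: those files are imported elsewhere, never edited; planner word
2026-08-27T03:25:10Z (A) «if a class needs a NEW anchor, add it in a t42 anchors file»). Per anchor, DECIDED BY THE KERNEL: minimality,
ellipticity, SPLIT multiplicative reduction at `2`, the conductor (squarefree: coprimality; additive `3`: Rizzo's Table II in the kernel;
additive `ℓ ≥ 5`: `f = 2`), the unique rational `2`-torsion point and its Greenberg type, `2 ∣ #Ẽ(𝔽_ℓ)` at good odd `ℓ`. The anchors'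
λ-invariant enters the doors ONLY through the displayed binders `hlanA : λ_an(A) = m + 1`, `hμanA`, `hrankA` of the class files (rows:
engine-1 kit j269322 (GVM-cert.gp verbatim: LAW PASS, MU0 YES) + engine-2 kit j269323 (afe2_engine.gp v2 verbatim) at these rank-1 anchor members — two-engine, t42 GEN 7) — EVIDENCE, never facts. Emitter: HOME/t42/gen/gen_anchorsfile.py + memberdata.py (port of the mult lane's genlaw5.py member block).
WHAT THIS IS NOT: not a door, not a certificate, not a discharge of anything.

References: [SilvermanAEC2009] VII.1, VII.3.1, VII.5.1, III.1–III.2; [Silverman1994] IV.10.2; [GreenbergLNM1716] §5, Prop. 5.14;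
[GreenbergVatsal2000] p. 4 (anchors); [CremonaAlgorithms1997] Table 1 (1170i2, 1246h1); [Rizzo2003] Table II.
-/

set_option autoImplicit false

open IsDedekindDomain WeierstrassCurve Literature.NumberTheory.EllipticCurves
  Literature.NumberTheory.EllipticCurves.ModularForms
  Literature.NumberTheory.EllipticCurves.Rank1Residual
  Literature.NumberTheory.EllipticCurves.Rank1Residual.Typed
  Literature.NumberTheory.EllipticCurves.Greenberg1999
  Literature.NumberTheory.EllipticCurves.PolyCert
  Literature.NumberTheory.EllipticCurves.Rank1Residual.X11RankOneCertificates
  Summit.BirchSwinnertonDyer.Rank1Residual.X1.MuPart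
  Summit.BirchSwinnertonDyer.Rank1Residual.X1.ParitySqueeze
  Summit.BirchSwinnertonDyer.Rank1Residual.X5.O1
  Summit.BirchSwinnertonDyer.BirchSwinnertonDyer.Rank2Observatory.RootNumber

open CongruenceSubgroup
open scoped MatrixGroups ModularForm

namespace Summit.BirchSwinnertonDyer.Rank1Residual.X5.Instances

/-! ## Anchor `1170i2` (`N = 1170`, split at `2`, type A, `x(P) = -21/4`) -/

/-- Cremona `1170i2` = `[1, -1, 1, -503, -2473]` (integer model). [cite: CremonaAlgorithms1997, Table 1] -/
abbrev M1170i2 : WeierstrassCurve ℤ := ⟨1, -1, 1, -503, -2473⟩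
/-- `1170i2 / ℚ`. [cite: CremonaAlgorithms1997, Table 1] -/
abbrev c1170i2 : WeierstrassCurve ℚ := M1170i2.baseChange ℚ
/-- `Δ(1170i2) = 2^3·3^3·5·13^6`. [cite: CremonaAlgorithms1997, Table 1] -/
theorem M1170i2_Δ : M1170i2.Δ = 5212953720 := by decide
/-- `c₄(1170i2)` (`|c₄| = 3^2·7·383`). [cite: CremonaAlgorithms1997, Table 1] -/
theorem M1170i2_c₄ : M1170i2.c₄ = 24129 := by decide
/-- `c₆(1170i2)`. [cite: CremonaAlgorithms1997, Table 1] -/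
theorem M1170i2_c₆ : M1170i2.c₆ = 2245023 := by decide
/-- **Rizzo's Table II at `1170i2`, evaluated in the kernel on the integer invariants** (`3^2 ∥ c₄`, `3^3 ∥ c₆`, `3^3 ∥ Δ`):
`v₃(N) = 2` (additive, tamely ramified). [cite: Rizzo2003, Table II (p. 4), column v(N)] -/
theorem condExp_1170i2 :
    Rizzo.condExpOfInvariants (M1170i2.c₄ : ℚ) (M1170i2.c₆ : ℚ) (M1170i2.Δ : ℚ) = 2 := by
  rw [M1170i2_c₄, M1170i2_c₆, M1170i2_Δ,
    condExpOfInvariants_intCast _ _ _ 2 3 3 (Or.inr (by decide)) (Or.inr (by decide)) (by decide)]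
  decide
/-- `1170i2` is an elliptic curve. [cite: CremonaAlgorithms1997, Table 1] -/
instance c1170i2_isElliptic : c1170i2.IsElliptic := by
  rw [WeierstrassCurve.isElliptic_iff, baseChange_int_Δ, M1170i2_Δ]; norm_num
/-- Cremona's model `1170i2` is globally minimal (integer criterion at the primes of `gcd(Δ, c₄) = 9`). [cite: SilvermanAEC2009, VII.1 Remark 1.1] -/
instance c1170i2_isGloballyMinimal : c1170i2.IsGloballyMinimal := by
  rw [c1170i2, baseChange_int_eq]
  refine isGloballyMinimal_of_int_criterion 1 (-1) 1 (-503) (-2473) (int_criterion_of_primeFactors_gcd (by decide) ?_)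
  have hg : (Int.gcd (discOf [1, -1, 1, -503, -2473]) (c4Of [1, -1, 1, -503, -2473])).primeFactors = {3} := by
    rw [show Int.gcd (discOf [1, -1, 1, -503, -2473]) (c4Of [1, -1, 1, -503, -2473]) = 9 by decide]; simp [Nat.primeFactors]
  rw [hg]; decide
/-- **`1170i2` is multiplicative at `2`** (`2 ∣ Δ`, `2 ∤ c₄`). [cite: SilvermanAEC2009, VII.5 Prop. 5.1(b)] -/
theorem mult_two_1170i2 : Mult c1170i2 2 := by
  have hgen : Rat.HeightOneSpectrum.natGenerator
      ((Rat.HeightOneSpectrum.primesEquiv (R := ℤ)).symm ⟨2, Nat.prime_two⟩) = 2 :=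
    Literature.NumberTheory.EllipticCurves.Rat.natGenerator_primesEquiv_symm ⟨2, Nat.prime_two⟩
  have hm : c1170i2.HasMultiplicativeReductionAt
      ((Rat.HeightOneSpectrum.primesEquiv (R := ℤ)).symm ⟨2, Nat.prime_two⟩) := by
    refine hasMultiplicativeReductionAt_of_valuation_c₄_eq_one (isIntegralAt_baseChange _ M1170i2) ?_ ?_
    · rw [baseChange_int_c₄, Literature.NumberTheory.EllipticCurves.Rat.valuation_intCast_eq_one_iff, hgen,
        M1170i2_c₄]; decide
    · rw [baseChange_int_Δ, Literature.NumberTheory.EllipticCurves.Rat.valuation_intCast_lt_one_iff, hgen,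
        M1170i2_Δ]; decide
  exact (hasMultiplicativeReductionAtPrime_iff_hasMultiplicativeReductionAt_holds c1170i2
    ⟨2, Nat.prime_two⟩).mpr hm
/-- `1170i2 mod 2`. [folklore] -/
theorem M1170i2_mod_two : M1170i2.map (Int.castRingHom (ZMod 2)) = ⟨1, 1, 1, 1, 1⟩ := by
  ext <;> decide
/-- **`1170i2` is SPLIT multiplicative at `2`** (the node quadratic has the root `0` in `𝔽₂`). [cite: SilvermanAEC2009, VII.5 Prop. 5.1(b)] -/
theorem split_two_1170i2 : c1170i2.HasSplitMultiplicativeReductionAtPrime 2 := by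
  have hint : integralModelInt c1170i2 = M1170i2 := integralModelInt_baseChange_int M1170i2
  have hΔ : ((2 : ℕ) : ℤ) ∣ (integralModelInt c1170i2).Δ := by rw [hint, M1170i2_Δ]; decide
  have hc₄ : ¬ ((2 : ℕ) : ℤ) ∣ (integralModelInt c1170i2).c₄ := by rw [hint, M1170i2_c₄]; decide
  rw [LocalTorsionMult.hasSplitMultiplicativeReductionAtPrime_iff_splits_integralModelInt c1170i2 2 hΔ
    hc₄, hint, M1170i2_mod_two]
  dsimp only
  rw [sub_eq_add_neg, ← Polynomial.C_neg]
  exact splits_quadratic_F2_of_root (by decide) 0 (by decide)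
/-- `1170 = 2 * 3 ^ 2 * 5 * 13`: factorization exponents. [folklore] -/
theorem nfact_1170i2 (p : ℕ) : (1170 : ℕ).factorization p =
    (if 2 = p then 1 else 0) + (if 3 = p then 2 else 0) + (if 5 = p then 1 else 0) + (if 13 = p then 1 else 0) := by
  rw [show (1170 : ℕ) = 2 * 3 ^ 2 * 5 * 13 by norm_num,
    Nat.factorization_mul (by norm_num) (by norm_num),
    Nat.factorization_mul (by norm_num) (by norm_num),
    Nat.factorization_mul (by norm_num) (by norm_num),
    Nat.factorization_pow,
    Nat.Prime.factorization (by norm_num : Nat.Prime 2),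
    Nat.Prime.factorization (by norm_num : Nat.Prime 3),
    Nat.Prime.factorization (by norm_num : Nat.Prime 5),
    Nat.Prime.factorization (by norm_num : Nat.Prime 13)]
  simp only [Finsupp.coe_add, Finsupp.coe_smul, Pi.add_apply, Pi.smul_apply, Finsupp.single_apply,
    smul_eq_mul]
  split_ifs <;> omega

/-- The conductor exponents of `1170i2`: `1` at the multiplicative primes, `2` at the additive ones (at `3`: Rizzo's Table II; at `ℓ ≥ 5`: ATAEC IV.10.2), `0` else.
[cite: Silverman1994, IV.10.2] [cite: Rizzo2003, Table II (p. 4), column v(N)] -/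
theorem factorization_conductorNorm_1170i2 (p : ℕ) (hp : p.Prime) :
    (c1170i2.conductorNorm ℤ).factorization p = (1170 : ℕ).factorization p := by
  have key : (c1170i2.conductorNorm ℤ).factorization p =
      c1170i2.conductorExponent ((Rat.HeightOneSpectrum.primesEquiv (R := ℤ)).symm ⟨p, hp⟩) :=
    factorization_conductorNorm_primesEquiv_symm c1170i2 ⟨p, hp⟩
  rw [key, nfact_1170i2]
  by_cases h2 : 2 = p
  · subst h2
    rw [conductorExponent_baseChange_int_eq_one M1170i2 hp (by rw [M1170i2_Δ]; decide)
      (by rw [M1170i2_c₄]; decide)]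
    norm_num
  by_cases h3 : 3 = p
  · subst h3
    rw [show ((Rat.HeightOneSpectrum.primesEquiv (R := ℤ)).symm ⟨3, hp⟩) =
        (Rat.HeightOneSpectrum.primesEquiv (R := ℤ)).symm ⟨3, Nat.prime_three⟩ from rfl,
      conductorExponent_baseChange_int_three M1170i2 condExp_1170i2]
    norm_num
  by_cases h5 : 5 = p
  · subst h5
    rw [conductorExponent_baseChange_int_eq_one M1170i2 hp (by rw [M1170i2_Δ]; decide)
      (by rw [M1170i2_c₄]; decide)]
    norm_num
  by_cases h13 : 13 = p
  · subst h13
    rw [conductorExponent_baseChange_int_eq_one M1170i2 hp (by rw [M1170i2_Δ]; decide)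
      (by rw [M1170i2_c₄]; decide)]
    norm_num
  rw [if_neg h2, if_neg h3, if_neg h5, if_neg h13]
  refine conductorExponent_baseChange_int_eq_zero M1170i2 hp fun hd ↦ ?_
  rw [M1170i2_Δ, show (5212953720 : ℤ) = 2 ^ 3 * 3 ^ 3 * 5 * 13 ^ 6 by norm_num] at hd
  have hp' : Prime (p : ℤ) := Nat.prime_iff_prime_int.mp hp
  rcases hp'.dvd_or_dvd hd with hd | h_13; swap
  · exact h13 ((Nat.prime_dvd_prime_iff_eq hp (by norm_num : Nat.Prime 13)).mp (by exact_mod_cast hp'.dvd_of_dvd_pow h_13)).symm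
  rcases hp'.dvd_or_dvd hd with hd | h_5; swap
  · exact h5 ((Nat.prime_dvd_prime_iff_eq hp (by norm_num : Nat.Prime 5)).mp (by exact_mod_cast h_5)).symm
  rcases hp'.dvd_or_dvd hd with hd | h_3; swap
  · exact h3 ((Nat.prime_dvd_prime_iff_eq hp (by norm_num : Nat.Prime 3)).mp (by exact_mod_cast hp'.dvd_of_dvd_pow h_3)).symm
  exact h2 ((Nat.prime_dvd_prime_iff_eq hp (by norm_num : Nat.Prime 2)).mp (by exact_mod_cast hp'.dvd_of_dvd_pow hd)).symm

/-- **`N(1170i2) = 1170`.** [cite: CremonaAlgorithms1997, Table 1] -/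
theorem conductorNorm_1170i2 : c1170i2.conductorNorm ℤ = 1170 := by
  refine Nat.eq_of_factorization_eq (c1170i2.conductorNorm_pos_holds).ne' (by norm_num) fun p ↦ ?_
  by_cases hp : p.Prime; · exact factorization_conductorNorm_1170i2 p hp
  rw [Nat.factorization_eq_zero_of_not_prime _ hp, Nat.factorization_eq_zero_of_not_prime _ hp]

/-- The coefficients of `1170i2 / ℚ` (unfolded). [cite: CremonaAlgorithms1997, Table 1] -/
theorem c1170i2_eq : c1170i2 = ⟨1, -1, 1, -503, -2473⟩ := by
  rw [c1170i2, baseChange_int_eq]; norm_num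
/-- `b₂, b₄, b₆` of `1170i2`; `2`-division cubic `= (x − (-21 / 4))(4x² + ((-24))x + ((-1884)))`. [cite: SilvermanAEC2009, III.1] -/
theorem c1170i2_b : c1170i2.b₂ = -3 ∧ c1170i2.b₄ = -1005 ∧ c1170i2.b₆ = -9891 := by
  rw [c1170i2_eq]
  simp only [WeierstrassCurve.b₂, WeierstrassCurve.b₄, WeierstrassCurve.b₆]
  norm_num
/-- The rational point `(-21/4, 17/8)` of order `2` on `1170i2`. [cite: CremonaAlgorithms1997, Table 1] -/
theorem c1170i2_P : c1170i2.toAffine.Equation (-21 / 4) (17 / 8) ∧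
    2 * ((17 / 8) : ℚ) + c1170i2.a₁ * (-21 / 4) + c1170i2.a₃ = 0 := by
  rw [c1170i2_eq, WeierstrassCurve.Affine.equation_iff]; norm_num
/-- **`(-21/4, 17/8)` is the ONLY rational point of order `2` on `1170i2`** (the cofactor `4x² + ((-24))x + ((-1884))` has non-square discriminant). [cite: SilvermanAEC2009, III.2.3] -/
theorem c1170i2_unique : HasUniqueRationalTwoTorsionX c1170i2 (-21 / 4) := by
  refine ⟨⟨(17 / 8), c1170i2_P⟩, fun z hz ↦ ?_⟩
  have hc := cubic_eq_zero_of_hasRationalTwoTorsionX hz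
  obtain ⟨hb₂, hb₄, hb₆⟩ := c1170i2_b
  rw [hb₂, hb₄, hb₆] at hc
  have hfac : (z - (-21 / 4)) * (4 * z ^ 2 + (-24) * z + (-1884)) = 0 := by linear_combination hc
  exact eq_of_cubic_factor_of_not_isSquare z hfac (by norm_num)
/-- `(-21/4, ·)` is "ramified at `2`" (`v₂(x) = −2`). [cite: GreenbergLNM1716, §5 (chunk p0176)] -/
theorem c1170i2_ram : TwoTorsionRamifiedAtTwo ((-21 / 4) : ℚ) := by
  have := twoTorsionRamifiedAtTwo_of_odd_div_four (-21) (by decide)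
  push_cast at this
  simpa [neg_div] using this
/-- `(-21/4, ·)` is NOT "odd": `(−u − √(u² − 16v))/8 < -21/4` is a smaller real root of the `2`-division cubic (`u = -24`, `v = -1884`).
[cite: GreenbergLNM1716, §5 Remark (chunk p0174)] -/
theorem c1170i2_not_odd : ¬ TwoTorsionOdd c1170i2 (-21 / 4) := by
  intro hodd
  obtain ⟨hb₂, hb₄, hb₆⟩ := c1170i2_b
  obtain ⟨r, hr, hlt⟩ := exists_cubic_root_lt (x₀ := ((-21 / 4) : ℝ)) (u := (-24)) (v := (-1884)) (by norm_num)
    ((Real.lt_sqrt (by norm_num)).mpr (by norm_num))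
  have := hodd r (by rw [hb₂, hb₄, hb₆]; push_cast; linear_combination hr)
  push_cast at this
  linarith
/-- **`(-21/4, ·)` is of Greenberg type A** (ramified at `2`, not odd). [cite: GreenbergLNM1716, Prop. 5.14 (p. 171)] -/
theorem c1170i2_typeAB : (TwoTorsionRamifiedAtTwo ((-21 / 4) : ℚ) ∧ ¬ TwoTorsionOdd c1170i2 (-21 / 4)) ∨
    (TwoTorsionOdd c1170i2 (-21 / 4) ∧ ¬ TwoTorsionRamifiedAtTwo ((-21 / 4) : ℚ)) :=
  Or.inl ⟨c1170i2_ram, c1170i2_not_odd⟩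

/-- `2 ∣ #Ẽ(𝔽_ℓ)` for `1170i2` at every good odd prime `ℓ` (a rational `2`-torsion point). [cite: SilvermanAEC2009, VII.3.1(b)] -/
theorem two_dvd_reductionPointCount_1170i2 {ℓ : ℕ} [Fact ℓ.Prime] (hℓ : 3 ≤ ℓ)
    (hΔ : ¬ (ℓ : ℤ) ∣ (5212953720 : ℤ)) : 2 ∣ c1170i2.reductionPointCount ℓ :=
  two_dvd_reductionPointCount_of_hasRationalTwoTorsionX ⟨(17 / 8), c1170i2_P⟩ hℓ
    (by rw [minimalDiscriminantInt_baseChange_int, M1170i2_Δ]; exact hΔ)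

/-! ## Anchor `1246h1` (`N = 1246`, split at `2`, type B, `x(P) = -7`) -/

/-- Cremona `1246h1` = `[1, -1, 1, -30, 173]` (integer model). [cite: CremonaAlgorithms1997, Table 1] -/
abbrev M1246h1 : WeierstrassCurve ℤ := ⟨1, -1, 1, -30, 173⟩
/-- `1246h1 / ℚ`. [cite: CremonaAlgorithms1997, Table 1] -/
abbrev c1246h1 : WeierstrassCurve ℚ := M1246h1.baseChange ℚ
/-- `Δ(1246h1) = −2^14·7·89`. [cite: CremonaAlgorithms1997, Table 1] -/
theorem M1246h1_Δ : M1246h1.Δ = -10207232 := by decide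
/-- `c₄(1246h1)` (`|c₄| = 3·5^2·19`). [cite: CremonaAlgorithms1997, Table 1] -/
theorem M1246h1_c₄ : M1246h1.c₄ = 1425 := by decide
/-- `1246h1` is an elliptic curve. [cite: CremonaAlgorithms1997, Table 1] -/
instance c1246h1_isElliptic : c1246h1.IsElliptic := by
  rw [WeierstrassCurve.isElliptic_iff, baseChange_int_Δ, M1246h1_Δ]; norm_num
/-- Cremona's model `1246h1` is globally minimal (`gcd(Δ, c₄) = 1`). [cite: SilvermanAEC2009, VII.1 Remark 1.1] -/
instance c1246h1_isGloballyMinimal : c1246h1.IsGloballyMinimal :=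
  isGloballyMinimal_baseChange_int_of_gcd_eq_one 1 (-1) 1 (-30) 173 (by decide)
/-- **`1246h1` is multiplicative at `2`** (`2 ∣ Δ`, `2 ∤ c₄`). [cite: SilvermanAEC2009, VII.5 Prop. 5.1(b)] -/
theorem mult_two_1246h1 : Mult c1246h1 2 := by
  have hgen : Rat.HeightOneSpectrum.natGenerator
      ((Rat.HeightOneSpectrum.primesEquiv (R := ℤ)).symm ⟨2, Nat.prime_two⟩) = 2 :=
    Literature.NumberTheory.EllipticCurves.Rat.natGenerator_primesEquiv_symm ⟨2, Nat.prime_two⟩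
  have hm : c1246h1.HasMultiplicativeReductionAt
      ((Rat.HeightOneSpectrum.primesEquiv (R := ℤ)).symm ⟨2, Nat.prime_two⟩) := by
    refine hasMultiplicativeReductionAt_of_valuation_c₄_eq_one (isIntegralAt_baseChange _ M1246h1) ?_ ?_
    · rw [baseChange_int_c₄, Literature.NumberTheory.EllipticCurves.Rat.valuation_intCast_eq_one_iff, hgen,
        M1246h1_c₄]; decide
    · rw [baseChange_int_Δ, Literature.NumberTheory.EllipticCurves.Rat.valuation_intCast_lt_one_iff, hgen,
        M1246h1_Δ]; decide
  exact (hasMultiplicativeReductionAtPrime_iff_hasMultiplicativeReductionAt_holds c1246h1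
    ⟨2, Nat.prime_two⟩).mpr hm
/-- `1246h1 mod 2`. [folklore] -/
theorem M1246h1_mod_two : M1246h1.map (Int.castRingHom (ZMod 2)) = ⟨1, 1, 1, 0, 1⟩ := by
  ext <;> decide
/-- **`1246h1` is SPLIT multiplicative at `2`** (the node quadratic has the root `0` in `𝔽₂`). [cite: SilvermanAEC2009, VII.5 Prop. 5.1(b)] -/
theorem split_two_1246h1 : c1246h1.HasSplitMultiplicativeReductionAtPrime 2 := by
  have hint : integralModelInt c1246h1 = M1246h1 := integralModelInt_baseChange_int M1246h1
  have hΔ : ((2 : ℕ) : ℤ) ∣ (integralModelInt c1246h1).Δ := by rw [hint, M1246h1_Δ]; decide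
  have hc₄ : ¬ ((2 : ℕ) : ℤ) ∣ (integralModelInt c1246h1).c₄ := by rw [hint, M1246h1_c₄]; decide
  rw [LocalTorsionMult.hasSplitMultiplicativeReductionAtPrime_iff_splits_integralModelInt c1246h1 2 hΔ
    hc₄, hint, M1246h1_mod_two]
  dsimp only
  rw [sub_eq_add_neg, ← Polynomial.C_neg]
  exact splits_quadratic_F2_of_root (by decide) 0 (by decide)
/-- `Δ(1246h1)`, `c₄(1246h1)` coprime (semistable model). [cite: SilvermanAEC2009, VII.5 Prop. 5.1(b)] -/
theorem M1246h1_coprime : IsCoprime M1246h1.Δ M1246h1.c₄ := by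
  rw [M1246h1_Δ, M1246h1_c₄, Int.isCoprime_iff_gcd_eq_one]; decide
/-- **The conductor of `1246h1` is `1246`** (semistable: the radical of `Δ`; Silverman ATAEC IV.10.2). [cite: CremonaAlgorithms1997, Table 1] [cite: Silverman1994, IV.10.2] -/
theorem conductorNorm_1246h1 : c1246h1.conductorNorm ℤ = 1246 := by
  refine conductorNorm_baseChange_int_of_isCoprime M1246h1 M1246h1_coprime (k := 14) ?_ ?_ ?_
  · rw [Nat.squarefree_iff_nodup_primeFactorsList (by norm_num)]; simp
  · rw [M1246h1_Δ]; decide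
  · rw [M1246h1_Δ]; decide

/-- The coefficients of `1246h1 / ℚ` (unfolded). [cite: CremonaAlgorithms1997, Table 1] -/
theorem c1246h1_eq : c1246h1 = ⟨1, -1, 1, -30, 173⟩ := by
  rw [c1246h1, baseChange_int_eq]; norm_num
/-- `b₂, b₄, b₆` of `1246h1`; `2`-division cubic `= (x − (-7))(4x² + ((-31))x + (99))`. [cite: SilvermanAEC2009, III.1] -/
theorem c1246h1_b : c1246h1.b₂ = -3 ∧ c1246h1.b₄ = -59 ∧ c1246h1.b₆ = 693 := by
  rw [c1246h1_eq]
  simp only [WeierstrassCurve.b₂, WeierstrassCurve.b₄, WeierstrassCurve.b₆]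
  norm_num
/-- The rational point `(-7, 3)` of order `2` on `1246h1`. [cite: CremonaAlgorithms1997, Table 1] -/
theorem c1246h1_P : c1246h1.toAffine.Equation (-7) 3 ∧
    2 * (3 : ℚ) + c1246h1.a₁ * (-7) + c1246h1.a₃ = 0 := by
  rw [c1246h1_eq, WeierstrassCurve.Affine.equation_iff]; norm_num
/-- **`(-7, 3)` is the ONLY rational point of order `2` on `1246h1`** (the cofactor `4x² + ((-31))x + (99)` has negative discriminant). [cite: SilvermanAEC2009, III.2.3] -/
theorem c1246h1_unique : HasUniqueRationalTwoTorsionX c1246h1 (-7) := by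
  refine ⟨⟨3, c1246h1_P⟩, fun z hz ↦ ?_⟩
  have hc := cubic_eq_zero_of_hasRationalTwoTorsionX hz
  obtain ⟨hb₂, hb₄, hb₆⟩ := c1246h1_b
  rw [hb₂, hb₄, hb₆] at hc
  have hfac : (z - (-7)) * (4 * z ^ 2 + (-31) * z + 99) = 0 := by linear_combination hc
  rcases mul_eq_zero.mp hfac with h | h
  · linarith
  · nlinarith [sq_nonneg (8 * z + (-31))]
/-- **`(-7, 3)` is "odd"**: the only real root of the `2`-division cubic. [cite: GreenbergLNM1716, §5 Remark (chunk p0174)] -/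
theorem c1246h1_odd : TwoTorsionOdd c1246h1 (-7) := by
  intro r hr
  obtain ⟨hb₂, hb₄, hb₆⟩ := c1246h1_b
  rw [hb₂, hb₄, hb₆] at hr
  push_cast at hr
  have hfac : (r - (-7)) * (4 * r ^ 2 + (-31) * r + 99) = 0 := by linear_combination hr
  rcases mul_eq_zero.mp hfac with h | h
  · push_cast; linarith
  · nlinarith [sq_nonneg (8 * r + (-31))]
/-- **`(-7, 3)` is of Greenberg type B** (odd, not ramified at `2`: `-7 ∈ ℤ`). [cite: GreenbergLNM1716, Prop. 5.14 (p. 171)] -/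
theorem c1246h1_typeAB : (TwoTorsionRamifiedAtTwo ((-7) : ℚ) ∧ ¬ TwoTorsionOdd c1246h1 (-7)) ∨
    (TwoTorsionOdd c1246h1 (-7) ∧ ¬ TwoTorsionRamifiedAtTwo ((-7) : ℚ)) :=
  Or.inr ⟨c1246h1_odd, by simpa using not_twoTorsionRamifiedAtTwo_intCast (-7)⟩

/-- `2 ∣ #Ẽ(𝔽_ℓ)` for `1246h1` at every good odd prime `ℓ` (a rational `2`-torsion point). [cite: SilvermanAEC2009, VII.3.1(b)] -/
theorem two_dvd_reductionPointCount_1246h1 {ℓ : ℕ} [Fact ℓ.Prime] (hℓ : 3 ≤ ℓ)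
    (hΔ : ¬ (ℓ : ℤ) ∣ (-10207232 : ℤ)) : 2 ∣ c1246h1.reductionPointCount ℓ :=
  two_dvd_reductionPointCount_of_hasRationalTwoTorsionX ⟨3, c1246h1_P⟩ hℓ
    (by rw [minimalDiscriminantInt_baseChange_int, M1246h1_Δ]; exact hΔ)

end Summit.BirchSwinnertonDyer.Rank1Residual.X5.Instances
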